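import Mathlib
import HarnessLib
import Literature.Analysis.FluidPDE.TypeIAncientMild
import Summits.NavierStokesRegularity.NavierStokesRegularity.Theorems.SqueezeCycleExtremalElementExistsExtraction
import Summits.NavierStokesRegularity.NavierStokesRegularity.Theorems.SymmetryModuliCountSymmetricLiouvillePeriodicBlowdown
import Summits.NavierStokesRegularity.NavierStokesRegularity.Theorems.SymmetryModuliCountSymmetricLiouvilleRotationCovariance
import Summits.NavierStokesRegularity.NavierStokesRegularity.Theorems.PoloidalWindowDoorPoloidalWindowRigidityUniformReturnWindowGap

/-!
# Route `PoloidalWindowDoor`, crux `PoloidalWindowRigidity` (stmt-NavierStokesRegularity-19708) — LINE 22 «uniform_return» v1.0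
# (ns-idea-8 g11, `Cruxes/PoloidalWindowRigidity/Lines/uniform_return.lean` cecf59ab1752; idea-crit-7 g7 PASS): support stub U1a
# `stub_returnWindowSmall : ReturnWindowSmall`, VERBATIM (the Cruxes-local `ReturnWindowSmall` unfolded)

Seat ns-es-p1 g8 (free prover hand on ⟨19708⟩; CLAIM announced on the ideators bus before proposing).

* `returnWindowSmall` — **blow-down AT THE SCALE OF AN APPROXIMATE PERIOD.**  For an element `U` of the Type-I ancient
  mild class `A_C` (`Literature.Analysis.FluidPDE.IsTypeIAncientMild C U`) and `ε > 0` there are `η > 0`, `R₀` such that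
  every translation `τ` with `‖τ‖ ≥ R₀` and GLOBAL scale-covariant defect `√(−t)‖U(t, x+τ) − U(t, x)‖ ≤ η` (all `t < 0`,
  all `x`) makes `U` ε-small on the time window `[−4‖τ‖², −‖τ‖²]`: `√(−t)‖U(t, x)‖ ≤ ε` there.

PROOF (KNSS 2009 §6-type zoom; template: the tree's `SymmetryModuliCountSymmetricLiouville.periodicBlowdownVanishing_axis`).
If not, there are `τₙ` (`‖τₙ‖ ≥ 1`, defects `≤ 1/(n+1)`) and bad points `(sₙ, xₙ)`, `sₙ ∈ [−4‖τₙ‖², −‖τₙ‖²]`,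
`√(−sₙ)‖U(sₙ, xₙ)‖ > ε`.  The zooms `vₙ(s, y) := λₙ U(λₙ² s, xₙ + λₙ y)`, `λₙ := √(−sₙ) ∈ [‖τₙ‖, 2‖τₙ‖]`, lie in `A_C`
(`Theorems.isTypeIAncientMild_zoom`), have `‖vₙ(−1, 0)‖ > ε`, and — the defect being SCALE-INVARIANT — the approximate
periods `eₙ := τₙ/λₙ`, `‖eₙ‖ ∈ [½, 1]`, with `‖vₙ(s, y + eₙ) − vₙ(s, y)‖ ≤ (n+1)⁻¹/√(−s)`.  Bolzano–Weierstrass in the closed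
unit ball gives `e_{ψ n} → e*`, `‖e*‖ ≥ ½`; F3 (`Theorems.exists_tendsto_of_isTypeIAncientMild_seq`, KNSS Lemma 6.1) gives a
further subsequence converging slice-wise locally uniformly to some `w ∈ A_C`; then `‖w(−1, 0)‖ ≥ ε` and, passing to the
limit in the approximate periodicity (`TendstoLocallyUniformly.tendsto_comp` along `y + e_{ψ(φ n)} → y + e*`, continuity of
the slices of `w`), `w` is EXACTLY `e*`-periodic.  A periodic element of `A_C` vanishes (the tree's
`periodicTypeIAncientLiouville`, re-assembled here WITHOUT importing a route cone: the blow-down lever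
`stub_periodicBlowdownVanishing` + `stub_rotationCovariance` give `√(−t)‖w(t)‖_∞ → 0` at `−∞`, and the landed windowed gap
`…UniformReturnWindowGap.windowGap` (U1b) propagates that smallness forward to every `t < 0`) — contradicting
`‖w(−1, 0)‖ ≥ ε`.  (`R₀` is immaterial by scale invariance; we take `R₀ = 1`.)

HONEST LABEL: ONE support stub (M) of a files-only PASSed line; it closes no cell, no crux and no route item; the research
residue `CellDefectiveReturnLeaf`, ⟨19708⟩ / ⟨20428⟩ and NS regularity stay OPEN — no summit statement is proved here.
-/

noncomputable section

-- the summit and its single sub-problem share the name (CONVENTIONS §1), as in every Theorems file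
set_option linter.dupNamespace false

namespace Summit.NavierStokesRegularity.NavierStokesRegularity.Theorems.PoloidalWindowDoorPoloidalWindowRigidityUniformReturnReturnWindowSmall

open Set Function Filter Topology Metric
open Literature.Analysis Literature.Analysis.FluidPDE
open Summit.NavierStokesRegularity.NavierStokesRegularity.Theorems.SymmetryModuliCountSymmetricLiouville

/-! ## The stub -/

/-- **U1a `ReturnWindowSmall` (VERBATIM, the Cruxes-local def unfolded): an almost-period of large norm and small GLOBAL
scale-covariant defect makes the profile small on the time window of its own scale** (module docstring for the proof). -/
theorem returnWindowSmall :
    ∀ (C : ℝ) (U : ℝ → EuclideanSpace ℝ (Fin 3) → EuclideanSpace ℝ (Fin 3)), IsTypeIAncientMild C U →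
      ∀ ε : ℝ, 0 < ε → ∃ η : ℝ, 0 < η ∧ ∃ R₀ : ℝ, ∀ τ : EuclideanSpace ℝ (Fin 3), R₀ ≤ ‖τ‖ →
        (∀ t : ℝ, t < 0 → ∀ x, Real.sqrt (-t) * ‖U t (x + τ) - U t x‖ ≤ η) →
        ∀ t ∈ Set.Icc (-(4 * ‖τ‖ ^ 2)) (-(‖τ‖ ^ 2)), ∀ x, Real.sqrt (-t) * ‖U t x‖ ≤ ε := by
  intro C U hU ε hε
  by_contra hcon
  push Not at hcon
  -- violators: `τ n` with `‖τ n‖ ≥ 1`, defect `≤ 1/(n+1)`, and a bad point `(s n, x n)` in the window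
  have hch : ∀ n : ℕ, ∃ τ : EuclideanSpace ℝ (Fin 3), ∃ sx : ℝ × EuclideanSpace ℝ (Fin 3), 1 ≤ ‖τ‖ ∧
      (∀ t : ℝ, t < 0 → ∀ x, Real.sqrt (-t) * ‖U t (x + τ) - U t x‖ ≤ 1 / ((n : ℝ) + 1)) ∧
      sx.1 ∈ Set.Icc (-(4 * ‖τ‖ ^ 2)) (-(‖τ‖ ^ 2)) ∧ ε < Real.sqrt (-sx.1) * ‖U sx.1 sx.2‖ := by
    intro n
    obtain ⟨τ, hτ1, hdef, t, ht, x, hx⟩ := hcon (1 / ((n : ℝ) + 1)) (by positivity) 1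
    exact ⟨τ, (t, x), hτ1, hdef, ht, hx⟩
  choose τ sx hτ1 hdef hwin hbig using hch
  set sn : ℕ → ℝ := fun n => (sx n).1 with hsn
  set xn : ℕ → EuclideanSpace ℝ (Fin 3) := fun n => (sx n).2 with hxn
  have hτpos : ∀ n, 0 < ‖τ n‖ := fun n => lt_of_lt_of_le one_pos (hτ1 n)
  have hsn_le : ∀ n, sn n ≤ -(‖τ n‖ ^ 2) := fun n => (hwin n).2
  have hsn_ge : ∀ n, -(4 * ‖τ n‖ ^ 2) ≤ sn n := fun n => (hwin n).1
  have hsn_neg : ∀ n, sn n < 0 := fun n => by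
    have := pow_pos (hτpos n) 2
    linarith [hsn_le n]
  -- the scales `λ n = √(-s n) ∈ [‖τ n‖, 2‖τ n‖]`
  set lam : ℕ → ℝ := fun n => Real.sqrt (-(sn n)) with hlam
  have hlam0 : ∀ n, 0 < lam n := fun n => Real.sqrt_pos.2 (neg_pos.2 (hsn_neg n))
  have hlam2 : ∀ n, lam n ^ 2 = -(sn n) := fun n => Real.sq_sqrt (neg_nonneg.2 (hsn_neg n).le)
  have hlam_ge : ∀ n, ‖τ n‖ ≤ lam n := fun n => by
    have h : Real.sqrt (‖τ n‖ ^ 2) ≤ Real.sqrt (-(sn n)) := Real.sqrt_le_sqrt (by linarith [hsn_le n])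
    rwa [Real.sqrt_sq (norm_nonneg _)] at h
  have hlam_le : ∀ n, lam n ≤ 2 * ‖τ n‖ := fun n => by
    have h : Real.sqrt (-(sn n)) ≤ Real.sqrt ((2 * ‖τ n‖) ^ 2) :=
      Real.sqrt_le_sqrt (by nlinarith [hsn_ge n])
    rwa [Real.sqrt_sq (by positivity)] at h
  -- the blow-downs
  set v : ℕ → ℝ → EuclideanSpace ℝ (Fin 3) → EuclideanSpace ℝ (Fin 3) :=
    fun n => lam n • stPull (lam n ^ 2) (lam n) 0 (xn n) U with hv
  have hvcl : ∀ n, IsTypeIAncientMild C (v n) := fun n => isTypeIAncientMild_zoom hU (hlam0 n) (xn n)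
  have hv_apply : ∀ n s y, v n s y = lam n • U (lam n ^ 2 * s) (xn n + lam n • y) := fun n s y =>
    zoom_apply (lam n) (xn n) U s y
  -- nontrivial at the interior point `(-1, 0)`
  have hv1 : ∀ n, ε < ‖v n (-1) 0‖ := by
    intro n
    rw [hv_apply, smul_zero, add_zero, mul_neg_one, hlam2, neg_neg, norm_smul,
      Real.norm_of_nonneg (hlam0 n).le]
    exact hbig n
  -- the rescaled approximate periods `e n = τ n / λ n`, of norm in `[1/2, 1]`
  set e : ℕ → EuclideanSpace ℝ (Fin 3) := fun n => (lam n)⁻¹ • τ n with he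
  have he_norm : ∀ n, ‖e n‖ = ‖τ n‖ / lam n := fun n => by
    simp only [he]
    rw [norm_smul, norm_inv, Real.norm_of_nonneg (hlam0 n).le, inv_mul_eq_div]
  have he_le : ∀ n, ‖e n‖ ≤ 1 := fun n => by
    rw [he_norm, div_le_one (hlam0 n)]
    exact hlam_ge n
  have he_ge : ∀ n, 1 / 2 ≤ ‖e n‖ := fun n => by
    rw [he_norm, le_div_iff₀ (hlam0 n)]
    linarith [hlam_le n]
  have hlam_e : ∀ n, lam n • e n = τ n := fun n => by
    simp only [he]
    rw [smul_inv_smul₀ (hlam0 n).ne']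
  -- approximate periodicity of the blow-downs: the defect is scale-invariant
  have hvdef : ∀ n, ∀ s < 0, ∀ y : EuclideanSpace ℝ (Fin 3),
      ‖v n s (y + e n) - v n s y‖ ≤ (1 / ((n : ℝ) + 1)) / Real.sqrt (-s) := by
    intro n s hs y
    have hss : 0 < Real.sqrt (-s) := Real.sqrt_pos.2 (by linarith)
    have hs' : lam n ^ 2 * s < 0 := mul_neg_of_pos_of_neg (pow_pos (hlam0 n) 2) hs
    rw [hv_apply, hv_apply, smul_add, hlam_e, ← add_assoc, ← smul_sub, norm_smul,
      Real.norm_of_nonneg (hlam0 n).le, le_div_iff₀ hss]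
    have h := hdef n (lam n ^ 2 * s) hs' (xn n + lam n • y)
    have hsq : Real.sqrt (-(lam n ^ 2 * s)) = lam n * Real.sqrt (-s) := by
      rw [show -(lam n ^ 2 * s) = lam n ^ 2 * (-s) by ring, Real.sqrt_mul' _ (neg_nonneg.2 hs.le),
        Real.sqrt_sq (hlam0 n).le]
    rw [hsq] at h
    calc lam n * ‖U (lam n ^ 2 * s) (xn n + lam n • y + τ n) - U (lam n ^ 2 * s) (xn n + lam n • y)‖ *
          Real.sqrt (-s)
        = lam n * Real.sqrt (-s) *
          ‖U (lam n ^ 2 * s) (xn n + lam n • y + τ n) - U (lam n ^ 2 * s) (xn n + lam n • y)‖ := by ring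
      _ ≤ 1 / ((n : ℝ) + 1) := h
  -- Bolzano–Weierstrass for the periods FIRST: `e (ψ n) → e*`, `‖e*‖ ≥ 1/2`
  obtain ⟨estar, -, ψ, hψ, hlim⟩ :=
    (isCompact_closedBall (0 : EuclideanSpace ℝ (Fin 3)) 1).tendsto_subseq
      (fun n => mem_closedBall_zero_iff.2 (he_le n))
  have hestar_ge : 1 / 2 ≤ ‖estar‖ :=
    ge_of_tendsto hlim.norm (Eventually.of_forall fun n => he_ge (ψ n))
  have hestar_ne : estar ≠ 0 := by
    intro h0
    rw [h0, norm_zero] at hestar_ge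
    norm_num at hestar_ge
  -- compactness of the class (F3, KNSS Lemma 6.1): a limit `w ∈ A_C` along a further subsequence
  have hF3 : ∀ v' : ℕ → ℝ → EuclideanSpace ℝ (Fin 3) → EuclideanSpace ℝ (Fin 3),
      (∀ n, IsTypeIAncientMild C (v' n)) →
      ∃ (φ : ℕ → ℕ) (W : ℝ → EuclideanSpace ℝ (Fin 3) → EuclideanSpace ℝ (Fin 3)),
        StrictMono φ ∧ IsTypeIAncientMild C W ∧
          ∀ t < 0, TendstoLocallyUniformly (fun n => v' (φ n) t) (W t) atTop := by
    intro v' hv'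
    obtain ⟨φ', hφ', W, hW, -, -, hloc', -⟩ := exists_tendsto_of_isTypeIAncientMild_seq C hv'
    exact ⟨φ', W, hφ', hW, hloc'⟩
  obtain ⟨φ, w, hφ, hw, hloc⟩ := hF3 (fun n => v (ψ n)) (fun n => hvcl (ψ n))
  have hwc : ∀ s < 0, Continuous (w s) := fun s hs => hw.continuous_slice hs
  have hpt : ∀ s < 0, ∀ y, Tendsto (fun n => v (ψ (φ n)) s y) atTop (𝓝 (w s y)) := fun s hs y =>
    (hloc s hs).tendsto_comp (hwc s hs).continuousAt tendsto_const_nhds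
  -- `‖w(-1, 0)‖ ≥ ε`
  have hw1 : ε ≤ ‖w (-1) 0‖ :=
    ge_of_tendsto ((hpt (-1) (by norm_num) 0).norm) (Eventually.of_forall fun n => (hv1 (ψ (φ n))).le)
  -- `w` is EXACTLY `e*`-periodic
  have hper : ∀ s < 0, ∀ y, w s (y + estar) = w s y := by
    intro s hs y
    have hss : 0 < Real.sqrt (-s) := Real.sqrt_pos.2 (by linarith)
    have hlim' : Tendsto (fun n => e (ψ (φ n))) atTop (𝓝 estar) := hlim.comp hφ.tendsto_atTop
    have hg : Tendsto (fun n => y + e (ψ (φ n))) atTop (𝓝 (y + estar)) := tendsto_const_nhds.add hlim'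
    have h1 : Tendsto (fun n => v (ψ (φ n)) s (y + e (ψ (φ n)))) atTop (𝓝 (w s (y + estar))) :=
      (hloc s hs).tendsto_comp (hwc s hs).continuousAt hg
    have h2 := hpt s hs y
    have hdiff : Tendsto (fun n => ‖v (ψ (φ n)) s (y + e (ψ (φ n))) - v (ψ (φ n)) s y‖) atTop
        (𝓝 ‖w s (y + estar) - w s y‖) := (h1.sub h2).norm
    -- the bound `(1/(ψ(φ n)+1))/√(-s) ≤ (1/(n+1))/√(-s) → 0`
    have hmono : StrictMono (ψ ∘ φ) := hψ.comp hφ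
    have hrhs : Tendsto (fun n : ℕ => (1 / ((n : ℝ) + 1)) / Real.sqrt (-s)) atTop (𝓝 0) := by
      have h := (tendsto_one_div_add_atTop_nhds_zero_nat).div_const (Real.sqrt (-s))
      rwa [zero_div] at h
    have hle : ∀ n, ‖v (ψ (φ n)) s (y + e (ψ (φ n))) - v (ψ (φ n)) s y‖ ≤
        (1 / ((n : ℝ) + 1)) / Real.sqrt (-s) := by
      intro n
      refine (hvdef (ψ (φ n)) s hs y).trans ?_
      have hn : (n : ℝ) ≤ (ψ (φ n) : ℝ) := by exact_mod_cast hmono.id_le n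
      gcongr
    have h0 : ‖w s (y + estar) - w s y‖ ≤ 0 :=
      le_of_tendsto_of_tendsto' hdiff hrhs hle
    have h00 : w s (y + estar) - w s y = 0 := norm_le_zero_iff.1 h0
    exact sub_eq_zero.1 h00
  -- the periodic Type-I Liouville theorem kills `w` (cone-free assembly): blow-down lever ⇒ small at `-∞` …
  have hsmall : ∀ ε' > 0, ∃ T < 0, ∀ t < T, ∀ x, Real.sqrt (-t) * ‖w t x‖ ≤ ε' :=
    stub_periodicBlowdownVanishing C hF3 (stub_rotationCovariance C) w hw estar hestar_ne hper
  -- … and the windowed gap (U1b) propagates the smallness forward to `t = -1`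
  obtain ⟨ε₁, hε₁, hgap⟩ := PoloidalWindowDoorPoloidalWindowRigidityUniformReturnWindowGap.windowGap C
  have key : ∀ ε' : ℝ, 0 < ε' → ε' ≤ ε₁ → ‖w (-1) 0‖ ≤ 2 * ε' := by
    intro ε' hε' hε'le
    obtain ⟨T₀, hT₀, hsm⟩ := hsmall ε' hε'
    have h1 : Real.sqrt (-(-1 : ℝ)) * ‖w (-1) 0‖ ≤ 2 * ε' := by
      by_cases hlt : (-1 : ℝ) < T₀
      · have h := hsm (-1) hlt 0
        linarith
      · have hT : 0 < 1 - T₀ := by linarith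
        have hwin : ∀ s ∈ Set.Icc (-(4 * (1 - T₀))) (-(1 - T₀)), ∀ y, Real.sqrt (-s) * ‖w s y‖ ≤ ε' :=
          fun s hs y => hsm s (by linarith [hs.2]) y
        exact hgap w hw (1 - T₀) ε' hT hε' hε'le hwin (-1) (by linarith) (by norm_num) 0
    rw [neg_neg, Real.sqrt_one, one_mul] at h1
    exact h1
  have h := key (min ε₁ (ε / 4)) (lt_min hε₁ (by positivity)) (min_le_left _ _)
  have hmin : min ε₁ (ε / 4) ≤ ε / 4 := min_le_right _ _
  linarith

end Summit.NavierStokesRegularity.NavierStokesRegularity.Theorems.PoloidalWindowDoorPoloidalWindowRigidityUniformReturnReturnWindowSmall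

end
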